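import Mathlib.MeasureTheory.Integral.Prod
import Literature.Analysis.FluidPDE.VortexFilament.CurlEnergy

/-!
# Curl energy of the test field, II: the flux term

Support file for the proof of the Jerrard–Seis energy lower bound
(`Literature.Analysis.FluidPDE.VortexFilament.JerrardSeis2016_filamentEnergyLowerBound`).
Continuing `CurlEnergy.lean`, the double integral `∫∫ (−ΔF)(x − γ(s)) ⟪ξ(x), γ'(s)⟫` is
evaluated: after Fubini and the translation `x = z + γ(s)`, the flux identity
`∫_{|z| ≤ ρ₁} (−ΔF) = 4π` of the kernel produces the main term `4π ∫ ξ · dμ_Γ`, while the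
errors are controlled by the small-translation bound for `ξ` (inner region, where `−ΔF` has
mass `O(1)` on `|z| ≤ ε`) and by `|ΔF| ≤ C L⁻³` against `∫ |ξ| ≤ L ∫ F ≤ 2√2 π L³` (outer
region).

## Contents

* `integral_integral_smear`, `integral_norm_testField_le`: Fubini for smears and the `L¹` bound
  `∫ |ξ| ≤ L ∫ F`.
* `inner_integral_laplacian_smul_le`: the flux-term estimate for one parameter `s`.
* `curl_energy_le`: `∫ |curl ξ|² ≤ 4π ∫ ξ · dμ_Γ + C K L` with an absolute constant expressed
  through the kernel constants — the analogue of
  `‖v^ε‖² = |log ε|/(2π) + O(‖κ*‖²)` and `|∫ v^ε · (v^ε − u)| ≲ ‖κ*‖` in [JerrardSeis2016, §4.3].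

No definitions are introduced.
-/

noncomputable section

open MeasureTheory Set Filter Function Metric
open scoped Topology InnerProductSpace RealInnerProductSpace ENNReal NNReal Real

namespace Literature.Analysis.FluidPDE

namespace VortexFilament

section MainTerm

variable {L : ℝ} {γ : ℝ → EuclideanSpace ℝ (Fin 3)}

/-- A compactly supported function vanishes outside a large ball. [folklore] -/
theorem exists_eq_zero_of_hasCompactSupport {V : Type*} [NormedAddCommGroup V]
    {Φ : EuclideanSpace ℝ (Fin 3) → V} (hΦs : HasCompactSupport Φ) :
    ∃ R, 0 ≤ R ∧ ∀ z, R < ‖z‖ → Φ z = 0 := by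
  obtain ⟨R, hR⟩ := (hΦs.isCompact.isBounded).subset_closedBall 0
  refine ⟨max R 0, le_max_right _ _, fun z hz => ?_⟩
  by_contra h
  have : z ∈ closedBall (0 : EuclideanSpace ℝ (Fin 3)) R := hR (subset_tsupport _ h)
  rw [mem_closedBall_zero_iff] at this
  linarith [le_max_left R 0]

/-- **Fubini for smears.** For `Φ` continuous with compact support and `0 ≤ L`,
`∫ (∫_{[0,L)} Φ(x − γ(s)) ds) dx = L ∫ Φ`, and the integrand is integrable on the product.
[folklore] -/
theorem integral_integral_smear (hγ : IsArclengthLoop L γ)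
    {Φ : EuclideanSpace ℝ (Fin 3) → ℝ} (hΦc : Continuous Φ) (hΦs : HasCompactSupport Φ) :
    Integrable (fun p : EuclideanSpace ℝ (Fin 3) × ℝ => Φ (p.1 - γ p.2))
      ((volume : Measure (EuclideanSpace ℝ (Fin 3))).prod (volume.restrict (Ico 0 L))) ∧
    ∫ x, ∫ s in Ico 0 L, Φ (x - γ s) = L * ∫ z, Φ z := by
  have hL := hγ.pos
  have hγc := hγ.lipschitz.continuous
  obtain ⟨M, hM⟩ := hγ.exists_bound
  obtain ⟨R, hR0, hR⟩ := exists_eq_zero_of_hasCompactSupport hΦs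
  obtain ⟨C, hC0, hC⟩ := exists_bound_of_continuous_hasCompactSupport hΦc hΦs
  set K : Set (EuclideanSpace ℝ (Fin 3)) := closedBall 0 (M + R) with hK
  -- domination by `C · 1_K(x)`
  have hdom_int : Integrable (fun p : EuclideanSpace ℝ (Fin 3) × ℝ => (K.indicator (fun _ => C) p.1) * (1:ℝ))
      ((volume : Measure (EuclideanSpace ℝ (Fin 3))).prod (volume.restrict (Ico 0 L))) := by
    refine Integrable.mul_prod (f := K.indicator fun _ => C) (g := fun _ : ℝ => (1:ℝ)) ?_
      (integrable_const (1:ℝ))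
    rw [integrable_indicator_iff measurableSet_closedBall]
    exact integrableOn_const (isCompact_closedBall _ _).measure_lt_top.ne
  have hmeas : AEStronglyMeasurable (fun p : EuclideanSpace ℝ (Fin 3) × ℝ => Φ (p.1 - γ p.2))
      ((volume : Measure (EuclideanSpace ℝ (Fin 3))).prod (volume.restrict (Ico 0 L))) :=
    (hΦc.comp (continuous_fst.sub (hγc.comp continuous_snd))).aestronglyMeasurable
  have hs : ∀ᵐ p : EuclideanSpace ℝ (Fin 3) × ℝ ∂((volume : Measure (EuclideanSpace ℝ (Fin 3))).prod
      (volume.restrict (Ico 0 L))), p.2 ∈ Ico (0:ℝ) L :=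
    (Measure.quasiMeasurePreserving_snd (μ := (volume : Measure (EuclideanSpace ℝ (Fin 3))))
      (ν := volume.restrict (Ico (0:ℝ) L))).ae (ae_restrict_mem measurableSet_Ico)
  have hint : Integrable (fun p : EuclideanSpace ℝ (Fin 3) × ℝ => Φ (p.1 - γ p.2))
      ((volume : Measure (EuclideanSpace ℝ (Fin 3))).prod (volume.restrict (Ico 0 L))) := by
    refine hdom_int.mono' hmeas ?_
    filter_upwards [hs] with p hp
    rw [mul_one, Real.norm_eq_abs]
    by_cases h : Φ (p.1 - γ p.2) = 0
    · rw [h, abs_zero]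
      simp only [Set.indicator]
      split_ifs <;> linarith
    · have h1 : ‖p.1 - γ p.2‖ ≤ R := by
        by_contra h2; exact h (hR _ (not_le.1 h2))
      have h2 : p.1 ∈ K := by
        rw [hK, mem_closedBall_zero_iff]
        calc ‖p.1‖ = ‖(p.1 - γ p.2) + γ p.2‖ := by rw [sub_add_cancel]
          _ ≤ ‖p.1 - γ p.2‖ + ‖γ p.2‖ := norm_add_le _ _
          _ ≤ R + M := add_le_add h1 (hM _ hp)
          _ = M + R := add_comm _ _
      rw [Set.indicator_of_mem h2]
      simpa [Real.norm_eq_abs] using hC (p.1 - γ p.2)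
  refine ⟨hint, ?_⟩
  have hswap := integral_integral_swap (μ := (volume : Measure (EuclideanSpace ℝ (Fin 3))))
    (ν := volume.restrict (Ico (0:ℝ) L)) (f := fun x s => Φ (x - γ s)) hint
  rw [hswap]
  have : ∀ s, ∫ x : EuclideanSpace ℝ (Fin 3), Φ (x - γ s) = ∫ z, Φ z := fun s =>
    integral_sub_right_eq_self Φ (γ s)
  simp_rw [this]
  rw [setIntegral_const, measureReal_def, Real.volume_Ico, sub_zero,
    ENNReal.toReal_ofReal hL.le, smul_eq_mul]

/-- **`L¹` bound for the test field**: `∫ |ξ| dx ≤ L ∫ F` for a nonnegative kernel `F`.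
[folklore] -/
theorem integral_norm_testField_le (hγ : IsArclengthLoop L γ)
    {F : EuclideanSpace ℝ (Fin 3) → ℝ} (hFc : Continuous F) (hFs : HasCompactSupport F)
    (hF0 : ∀ z, 0 ≤ F z) {ξ : EuclideanSpace ℝ (Fin 3) → EuclideanSpace ℝ (Fin 3)}
    (hξ : ξ = fun x => ∫ s in Ico 0 L, F (x - γ s) • deriv γ s) :
    ∫ x, ‖ξ x‖ ≤ L * ∫ z, F z := by
  obtain ⟨hint, hfub⟩ := integral_integral_smear hγ hFc hFs
  rw [← hfub]
  refine integral_mono_of_nonneg (ae_of_all _ fun _ => norm_nonneg _) hint.integral_prod_left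
    (ae_of_all _ fun x => ?_)
  rw [hξ]
  refine (norm_integral_le_integral_norm _).trans (integral_mono_of_nonneg
    (ae_of_all _ fun _ => norm_nonneg _) ?_ (ae_of_all _ fun s => ?_))
  · exact ((hFc.comp (continuous_const.sub hγ.lipschitz.continuous)).integrableOn_Icc
      (a := 0) (b := L)).mono_set Ico_subset_Icc_self
  · show ‖F (x - γ s) • deriv γ s‖ ≤ F (x - γ s)
    rw [norm_smul, Real.norm_eq_abs, abs_of_nonneg (hF0 _)]
    calc F (x - γ s) * ‖deriv γ s‖ ≤ F (x - γ s) * 1 :=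
          mul_le_mul_of_nonneg_left (hγ.norm_deriv_le_one s) (hF0 _)
      _ = F (x - γ s) := mul_one _

/-- Measurability of `s ↦ ⟪u(s), γ'(s)⟫`-type integrands. [folklore] -/
theorem IsArclengthLoop.integrable_inner_deriv (hγ : IsArclengthLoop L γ)
    {u : ℝ → EuclideanSpace ℝ (Fin 3)} (huc : Continuous u) {C : ℝ} (hC : ∀ s, ‖u s‖ ≤ C) :
    Integrable (fun s => ⟪u s, deriv γ s⟫) (volume.restrict (Ico 0 L)) := by
  have hm : AEStronglyMeasurable (fun s => ⟪u s, deriv γ s⟫) (volume.restrict (Ico 0 L)) :=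
    (huc.measurable.inner (_root_.measurable_deriv γ)).aestronglyMeasurable
  refine Integrable.of_bound hm C (ae_of_all _ fun s => ?_)
  rw [Real.norm_eq_abs]
  calc |⟪u s, deriv γ s⟫| ≤ ‖u s‖ * ‖deriv γ s‖ := abs_real_inner_le_norm _ _
    _ ≤ C * 1 := mul_le_mul (hC s) (hγ.norm_deriv_le_one s) (norm_nonneg _)
        ((norm_nonneg _).trans (hC s))
    _ = C := mul_one _

/-- **The flux term.** For a continuous "Laplacian profile" `lap` which is `O(ε⁻³)` on
`|z| ≤ ε`, vanishes on `ε < |z| < L/2`, is `O(L⁻³)` for `|z| ≥ L/2` and has flux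
`∫_{|z| ≤ ρ₁} lap = −4π`, and a continuous compactly supported field `ξ` with the
small-translation bound `|ξ(c + z) − ξ(c)| ≤ D` (`|z| ≤ ε`) and `∫ |ξ| ≤ I`, one has
`⟪∫ (−lap)(z) ξ(z + c) dz, τ⟫ ≤ 4π ⟪ξ(c), τ⟫ + (4π/3) C₂ D + C₃ L⁻³ I` for `|τ| ≤ 1`:
split the integral at `|z| = ρ₁ ∈ (ε, L/2)`; inside, `∫ (−lap) = 4π` and `−lap` has mass
`≤ (4π/3) C₂` on `|z| ≤ ε`; outside, `|lap| ≤ C₃ L⁻³`. [folklore] -/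
theorem inner_integral_laplacian_smul_le {lap : EuclideanSpace ℝ (Fin 3) → ℝ}
    (hlapc : Continuous lap) {ε L C₂ C₃ D I : ℝ} (hε : 0 < ε) (hεL : 2 * ε < L) (hC₂ : 0 ≤ C₂)
    (hC₃ : 0 ≤ C₃) (hD : 0 ≤ D)
    (hlap_in : ∀ z, ‖z‖ ≤ ε → |lap z| ≤ C₂ * ε⁻¹ ^ 3)
    (hlap_mid : ∀ z, ε < ‖z‖ → ‖z‖ < L / 2 → lap z = 0)
    (hlap_out : ∀ z, L / 2 ≤ ‖z‖ → |lap z| ≤ C₃ * L⁻¹ ^ 3)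
    (hflux : ∀ ρ₁ : ℝ, ε < ρ₁ → ρ₁ < L / 2 →
      ∫ z in closedBall (0 : EuclideanSpace ℝ (Fin 3)) ρ₁, lap z = -4 * π)
    {ξ : EuclideanSpace ℝ (Fin 3) → EuclideanSpace ℝ (Fin 3)} (hξc : Continuous ξ)
    (hξs : HasCompactSupport ξ)
    (hsub : ∀ c z : EuclideanSpace ℝ (Fin 3), ‖z‖ ≤ ε → ‖ξ (c + z) - ξ c‖ ≤ D)
    (hξL1 : ∫ x, ‖ξ x‖ ≤ I) (c τ : EuclideanSpace ℝ (Fin 3)) (hτ1 : ‖τ‖ ≤ 1) :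
    ⟪∫ z, (-lap z) • ξ (z + c), τ⟫ ≤
      4 * π * ⟪ξ c, τ⟫ + (C₂ * D * (π * 4 / 3) + C₃ * L⁻¹ ^ 3 * I) := by
  have hL : 0 < L := by linarith
  set E₁ : ℝ := C₂ * D * (π * 4 / 3) with hE₁
  set E₂ : ℝ := C₃ * L⁻¹ ^ 3 * I with hE₂
  set ρ₁ : ℝ := (ε + L / 2) / 2 with hρ₁
  have hρ₁ε : ε < ρ₁ := by rw [hρ₁]; linarith
  have hρ₁L : ρ₁ < L / 2 := by rw [hρ₁]; linarith
  set B : Set (EuclideanSpace ℝ (Fin 3)) := closedBall 0 ρ₁ with hB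
  -- integrability of the pieces
  have hξc' : Continuous fun z : EuclideanSpace ℝ (Fin 3) => ξ (z + c) :=
    hξc.comp (continuous_id.add continuous_const)
  have hgc : Continuous fun z : EuclideanSpace ℝ (Fin 3) => (-lap z) • ξ (z + c) :=
    hlapc.neg.smul hξc'
  have hξcs : HasCompactSupport fun z : EuclideanSpace ℝ (Fin 3) => ξ (z + c) :=
    hξs.comp_homeomorph (Homeomorph.addRight c)
  have hg : Integrable fun z : EuclideanSpace ℝ (Fin 3) => (-lap z) • ξ (z + c) :=
    hgc.integrable_of_hasCompactSupport (hξcs.smul_left (f := fun z => -lap z))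
  -- split `∫ = ∫_B + ∫_{Bᶜ}`
  have hsplit : ∫ z, (-lap z) • ξ (z + c) =
      (∫ z in B, (-lap z) • ξ (z + c)) + ∫ z in Bᶜ, (-lap z) • ξ (z + c) :=
    (integral_add_compl measurableSet_closedBall hg).symm
  -- on `B`: flux identity plus small-translation error
  have hB1 : ∫ z in B, (-lap z) • ξ (z + c) =
      (4 * π) • ξ c + ∫ z in B, (-lap z) • (ξ (z + c) - ξ c) := by
    have h1 : (fun z => (-lap z) • ξ (z + c)) =
        fun z => (-lap z) • ξ c + (-lap z) • (ξ (z + c) - ξ c) := by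
      funext z; rw [← smul_add, add_sub_cancel]
    have i1 : IntegrableOn (fun z => (-lap z) • ξ c) B :=
      (hlapc.neg.smul continuous_const).continuousOn.integrableOn_compact (isCompact_closedBall _ _)
    have i2 : IntegrableOn (fun z => (-lap z) • (ξ (z + c) - ξ c)) B :=
      (hlapc.neg.smul (hξc'.sub continuous_const)).continuousOn.integrableOn_compact
        (isCompact_closedBall _ _)
    rw [h1, integral_add i1 i2]
    congr 1
    rw [integral_smul_const, integral_neg, hflux ρ₁ hρ₁ε hρ₁L]
    congr 1; ring
  have hB2 : ‖∫ z in B, (-lap z) • (ξ (z + c) - ξ c)‖ ≤ E₁ := by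
    have hpt : ∀ z ∈ B, ‖(-lap z) • (ξ (z + c) - ξ c)‖ ≤
        (closedBall (0 : EuclideanSpace ℝ (Fin 3)) ε).indicator
          (fun _ => C₂ * ε⁻¹ ^ 3 * D) z := by
      intro z hz
      rw [hB, mem_closedBall_zero_iff] at hz
      rw [norm_smul, norm_neg, Real.norm_eq_abs]
      by_cases hzε : ‖z‖ ≤ ε
      · rw [Set.indicator_of_mem (mem_closedBall_zero_iff.2 hzε)]
        refine mul_le_mul (hlap_in z hzε) ?_ (norm_nonneg _) (by positivity)
        rw [add_comm]; exact hsub c z hzε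
      · push Not at hzε
        have : lap z = 0 := hlap_mid z hzε (lt_of_le_of_lt hz hρ₁L)
        rw [this, abs_zero, zero_mul]
        exact Set.indicator_nonneg (fun _ _ => by positivity) _
    have i3 : IntegrableOn (fun z => ‖(-lap z) • (ξ (z + c) - ξ c)‖) B :=
      (hlapc.neg.smul (hξc'.sub continuous_const)).norm.continuousOn.integrableOn_compact
        (isCompact_closedBall _ _)
    have i4 : IntegrableOn ((closedBall (0 : EuclideanSpace ℝ (Fin 3)) ε).indicator
        (fun _ => C₂ * ε⁻¹ ^ 3 * D)) B := by
      refine IntegrableOn.indicator ?_ measurableSet_closedBall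
      exact integrableOn_const (isCompact_closedBall _ _).measure_lt_top.ne
    calc ‖∫ z in B, (-lap z) • (ξ (z + c) - ξ c)‖
        ≤ ∫ z in B, ‖(-lap z) • (ξ (z + c) - ξ c)‖ := norm_integral_le_integral_norm _
      _ ≤ ∫ z in B, (closedBall (0 : EuclideanSpace ℝ (Fin 3)) ε).indicator
            (fun _ => C₂ * ε⁻¹ ^ 3 * D) z := setIntegral_mono_on i3 i4 measurableSet_closedBall hpt
      _ = C₂ * ε⁻¹ ^ 3 * D *
            (volume (closedBall (0 : EuclideanSpace ℝ (Fin 3)) ε)).toReal := by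
          rw [setIntegral_indicator measurableSet_closedBall]
          have : B ∩ closedBall 0 ε = closedBall (0 : EuclideanSpace ℝ (Fin 3)) ε :=
            inter_eq_right.2 (closedBall_subset_closedBall hρ₁ε.le)
          rw [this, setIntegral_const, measureReal_def, smul_eq_mul, mul_comm]
      _ = E₁ := by
          rw [EuclideanSpace.volume_closedBall_fin_three, ENNReal.toReal_mul,
            ← ENNReal.ofReal_pow hε.le, ENNReal.toReal_ofReal (by positivity),
            ENNReal.toReal_ofReal (by positivity), hE₁]
          field_simp
  -- on `Bᶜ`: small Laplacian against the `L¹` norm of `ξ`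
  have hB3 : ‖∫ z in Bᶜ, (-lap z) • ξ (z + c)‖ ≤ E₂ := by
    have hpt : ∀ z ∈ Bᶜ, ‖(-lap z) • ξ (z + c)‖ ≤ C₃ * L⁻¹ ^ 3 * ‖ξ (z + c)‖ := by
      intro z hz
      rw [hB, mem_compl_iff, mem_closedBall_zero_iff, not_le] at hz
      rw [norm_smul, norm_neg, Real.norm_eq_abs]
      refine mul_le_mul_of_nonneg_right ?_ (norm_nonneg _)
      rcases lt_or_ge ‖z‖ (L / 2) with h' | h'
      · rw [hlap_mid z (hρ₁ε.trans hz) h', abs_zero]; positivity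
      · exact hlap_out z h'
    have hint_shift : Integrable fun z : EuclideanSpace ℝ (Fin 3) => ‖ξ (z + c)‖ :=
      hξc'.norm.integrable_of_hasCompactSupport hξcs.norm
    have hI : ∫ z, ‖ξ z‖ ≤ I := hξL1
    have hI0 : 0 ≤ ∫ z, ‖ξ z‖ := integral_nonneg fun _ => norm_nonneg _
    calc ‖∫ z in Bᶜ, (-lap z) • ξ (z + c)‖
        ≤ ∫ z in Bᶜ, ‖(-lap z) • ξ (z + c)‖ := norm_integral_le_integral_norm _
      _ ≤ ∫ z in Bᶜ, C₃ * L⁻¹ ^ 3 * ‖ξ (z + c)‖ :=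
          setIntegral_mono_on hg.norm.integrableOn (hint_shift.const_mul _).integrableOn
            measurableSet_closedBall.compl hpt
      _ ≤ ∫ z, C₃ * L⁻¹ ^ 3 * ‖ξ (z + c)‖ :=
          setIntegral_le_integral (hint_shift.const_mul _) (ae_of_all _ fun z => by positivity)
      _ = C₃ * L⁻¹ ^ 3 * ∫ z, ‖ξ z‖ := by
          rw [integral_const_mul]
          congr 1
          exact integral_add_right_eq_self (fun z => ‖ξ z‖) c
      _ ≤ E₂ := by rw [hE₂]; gcongr
  -- assemble
  rw [hsplit, hB1, inner_add_left, inner_add_left, real_inner_smul_left]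
  have e1 : ⟪∫ z in B, (-lap z) • (ξ (z + c) - ξ c), τ⟫ ≤ E₁ := by
    calc ⟪∫ z in B, (-lap z) • (ξ (z + c) - ξ c), τ⟫
        ≤ ‖∫ z in B, (-lap z) • (ξ (z + c) - ξ c)‖ * ‖τ‖ := real_inner_le_norm _ _
      _ ≤ E₁ * 1 := mul_le_mul hB2 hτ1 (norm_nonneg _) ((norm_nonneg _).trans hB2)
      _ = E₁ := mul_one _
  have e2 : ⟪∫ z in Bᶜ, (-lap z) • ξ (z + c), τ⟫ ≤ E₂ := by
    calc ⟪∫ z in Bᶜ, (-lap z) • ξ (z + c), τ⟫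
        ≤ ‖∫ z in Bᶜ, (-lap z) • ξ (z + c)‖ * ‖τ‖ := real_inner_le_norm _ _
      _ ≤ E₂ * 1 := mul_le_mul hB3 hτ1 (norm_nonneg _) ((norm_nonneg _).trans hB3)
      _ = E₂ := mul_one _
  linarith

/-- **The curl energy of the test field is controlled by the line integral.** For the test
field `ξ = F ∗ μ_Γ` built on the kernel of `exists_kernel` at scales `ε` and `R = L`
(`2ε < L`), `∫ |curl ξ|² ≤ 4π ∫ ξ · dμ_Γ + C K L` with an absolute `C` (depending only on the
kernel constants): after the integration by parts `integral_norm_sq_curl_le` and Fubini, for each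
`s` one has `∫ (−ΔF)(x − γ(s)) ξ(x) dx = ∫ (−ΔF)(z) ξ(z + γ(s)) dz`; on `|z| ≤ ρ₁` the flux
identity `∫ (−ΔF) = 4π` produces `4π ξ(γ(s))` up to the small-translation error
`|ξ(z + γ(s)) − ξ(γ(s))| ≤ 192 C_g K` (`−ΔF` lives on `|z| ≤ ε` there, with mass `≤ (4π/3) C₂`),
and on `|z| > ρ₁` the bound `|ΔF| ≤ C₃ L⁻³` together with `∫ |ξ| ≤ L ∫ F ≤ 2√2 π L³` gives an
absolute error. This is the analogue of [JerrardSeis2016, §4.3: `|∫ v^ε · (v^ε − u)| ≲ ‖κ*‖`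
and (ve.2)]. [cite: JerrardSeis2016, §4.3 (proof of Thm 1, first assertion)] -/
theorem curl_energy_le (hγ : IsArclengthLoop L γ) {K : ℝ≥0}
    (hK : weakL1Norm L (kappaStar L γ) ≤ K) {ε Cg C₂ C₃ : ℝ} (hε : 0 < ε) (hεL : 2 * ε < L)
    (hCg : 0 ≤ Cg) (hC₂ : 0 ≤ C₂) (hC₃ : 0 ≤ C₃)
    {F : EuclideanSpace ℝ (Fin 3) → ℝ} {q₁ q₂ : ℝ → ℝ} (hF2 : ContDiff ℝ 2 F)
    (hq₁ : Continuous q₁) (hq₂ : Continuous q₂)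
    (hFL : ∀ z : EuclideanSpace ℝ (Fin 3), L ≤ ‖z‖ → F z = 0)
    (hF0 : ∀ z : EuclideanSpace ℝ (Fin 3), 0 ≤ F z)
    (hF' : ∀ z : EuclideanSpace ℝ (Fin 3), HasFDerivAt F ((2 * q₁ (‖z‖ ^ 2)) • innerSL ℝ z) z)
    (hG' : ∀ (z : EuclideanSpace ℝ (Fin 3)) (j : Fin 3),
      HasFDerivAt (fun w : EuclideanSpace ℝ (Fin 3) => 2 * q₁ (‖w‖ ^ 2) * w j)
        ((2 * q₁ (‖z‖ ^ 2)) • innerSL ℝ (EuclideanSpace.single j (1:ℝ)) +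
          (z j) • ((4 * q₂ (‖z‖ ^ 2)) • innerSL ℝ z)) z)
    (hgrad : ∀ z : EuclideanSpace ℝ (Fin 3), ‖fderiv ℝ F z‖ ≤ Cg * ((max ε ‖z‖)⁻¹) ^ 2)
    (hlap_in : ∀ z : EuclideanSpace ℝ (Fin 3), ‖z‖ ≤ ε →
      |4 * q₂ (‖z‖ ^ 2) * ‖z‖ ^ 2 + 6 * q₁ (‖z‖ ^ 2)| ≤ C₂ * ε⁻¹ ^ 3)
    (hlap_mid : ∀ z : EuclideanSpace ℝ (Fin 3), ε < ‖z‖ → ‖z‖ < L / 2 →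
      4 * q₂ (‖z‖ ^ 2) * ‖z‖ ^ 2 + 6 * q₁ (‖z‖ ^ 2) = 0)
    (hlap_out : ∀ z : EuclideanSpace ℝ (Fin 3), L / 2 ≤ ‖z‖ →
      |4 * q₂ (‖z‖ ^ 2) * ‖z‖ ^ 2 + 6 * q₁ (‖z‖ ^ 2)| ≤ C₃ * L⁻¹ ^ 3)
    (hflux : ∀ ρ₁ : ℝ, ε < ρ₁ → ρ₁ < L / 2 →
      ∫ z in closedBall (0 : EuclideanSpace ℝ (Fin 3)) ρ₁,
        (4 * q₂ (‖z‖ ^ 2) * ‖z‖ ^ 2 + 6 * q₁ (‖z‖ ^ 2)) = -4 * π)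
    (hFL1 : ∫ z, F z ≤ 2 * Real.sqrt 2 * π * L ^ 2)
    {ξ : EuclideanSpace ℝ (Fin 3) → EuclideanSpace ℝ (Fin 3)}
    (hξ : ξ = fun x => ∫ s in Ico 0 L, F (x - γ s) • deriv γ s) :
    ∫ x, ‖curl ξ x‖ ^ 2 ≤ 4 * π * tangentLineIntegral L γ ξ +
      (256 * π * Cg * C₂ + 2 * Real.sqrt 2 * π * C₃) * K * L := by
  have hL : 0 < L := hγ.pos
  have hK2 : (2:ℝ) ≤ K := hγ.two_le_of_weakL1Norm_le hK
  have hK0 : (0:ℝ) ≤ K := K.2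
  have hγc := hγ.lipschitz.continuous
  have hF1 : ContDiff ℝ 1 F := hF2.of_le (by norm_num)
  have hFc : Continuous F := hF2.continuous
  have hFs : HasCompactSupport F := by
    refine HasCompactSupport.intro (isCompact_closedBall (0 : EuclideanSpace ℝ (Fin 3)) L) ?_
    intro z hz
    rw [mem_closedBall_zero_iff, not_le] at hz
    exact hFL z hz.le
  -- the Laplacian profile and its bounds
  set lap : EuclideanSpace ℝ (Fin 3) → ℝ :=
    fun z => 4 * q₂ (‖z‖ ^ 2) * ‖z‖ ^ 2 + 6 * q₁ (‖z‖ ^ 2) with hlap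
  have hlapc : Continuous lap := by
    have h1 : Continuous fun w : EuclideanSpace ℝ (Fin 3) => q₂ (‖w‖ ^ 2) :=
      hq₂.comp (continuous_norm.pow 2)
    have h2 : Continuous fun w : EuclideanSpace ℝ (Fin 3) => q₁ (‖w‖ ^ 2) :=
      hq₁.comp (continuous_norm.pow 2)
    simp only [hlap]; fun_prop
  set Clap : ℝ := max (C₂ * ε⁻¹ ^ 3) (C₃ * L⁻¹ ^ 3) with hClap
  have hClap0 : 0 ≤ Clap := le_max_of_le_left (by positivity)
  have hlap_bd : ∀ z, |lap z| ≤ Clap := by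
    intro z
    rcases le_or_gt ‖z‖ ε with h | h
    · exact (hlap_in z h).trans (le_max_left _ _)
    rcases lt_or_ge ‖z‖ (L / 2) with h' | h'
    · show |4 * q₂ (‖z‖ ^ 2) * ‖z‖ ^ 2 + 6 * q₁ (‖z‖ ^ 2)| ≤ Clap
      rw [hlap_mid z h h', abs_zero]; exact hClap0
    · exact (hlap_out z h').trans (le_max_right _ _)
  -- the test field: regularity, support, bounds
  have hξ1 : ContDiff ℝ 1 ξ := contDiff_one_testField hγ hF1 hFs hξ
  have hξc : Continuous ξ := hξ1.continuous
  have hξs : HasCompactSupport ξ := hasCompactSupport_testField hγ hFL hξ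
  obtain ⟨Cξ, hCξ0, hCξ⟩ := exists_bound_of_continuous_hasCompactSupport hξc hξs
  have hξn_int : Integrable fun x => ‖ξ x‖ :=
    (hξc.norm).integrable_of_hasCompactSupport hξs.norm
  have hξL1 : ∫ x, ‖ξ x‖ ≤ L * (2 * Real.sqrt 2 * π * L ^ 2) :=
    (integral_norm_testField_le hγ hFc hFs hF0 hξ).trans (mul_le_mul_of_nonneg_left hFL1 hL.le)
  have hsub := fun (c z : EuclideanSpace ℝ (Fin 3)) (hz : ‖z‖ ≤ ε) =>
    norm_testField_sub_le hγ hK hε hCg hF1 hFs hgrad hξ c z hz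
  -- Step 1: integration by parts
  have h0 := integral_norm_sq_curl_le hγ hF2 hFs hF' hG' hq₁ hq₂ hξ
  -- Step 2: Fubini
  set f : EuclideanSpace ℝ (Fin 3) → ℝ → ℝ := fun x s => -lap (x - γ s) * ⟪ξ x, deriv γ s⟫ with hf
  have hf_meas : AEStronglyMeasurable (uncurry f)
      ((volume : Measure (EuclideanSpace ℝ (Fin 3))).prod (volume.restrict (Ico 0 L))) := by
    refine Measurable.aestronglyMeasurable ?_
    refine ((hlapc.comp (continuous_fst.sub (hγc.comp continuous_snd))).measurable.neg).mul ?_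
    exact (hξc.measurable.comp measurable_fst).inner ((_root_.measurable_deriv γ).comp measurable_snd)
  have hf_int : Integrable (uncurry f)
      ((volume : Measure (EuclideanSpace ℝ (Fin 3))).prod (volume.restrict (Ico 0 L))) := by
    have hdom : Integrable (fun p : EuclideanSpace ℝ (Fin 3) × ℝ => (Clap * ‖ξ p.1‖) * (1:ℝ))
        ((volume : Measure (EuclideanSpace ℝ (Fin 3))).prod (volume.restrict (Ico 0 L))) :=
      Integrable.mul_prod (f := fun x => Clap * ‖ξ x‖) (g := fun _ : ℝ => (1:ℝ))
        (hξn_int.const_mul Clap) (integrable_const (1:ℝ))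
    refine hdom.mono' hf_meas (ae_of_all _ fun p => ?_)
    show ‖-lap (p.1 - γ p.2) * ⟪ξ p.1, deriv γ p.2⟫‖ ≤ Clap * ‖ξ p.1‖ * 1
    rw [norm_mul, norm_neg, Real.norm_eq_abs, Real.norm_eq_abs, mul_one]
    refine mul_le_mul (hlap_bd _) ?_ (abs_nonneg _) hClap0
    calc |⟪ξ p.1, deriv γ p.2⟫| ≤ ‖ξ p.1‖ * ‖deriv γ p.2‖ := abs_real_inner_le_norm _ _
      _ ≤ ‖ξ p.1‖ * 1 := mul_le_mul_of_nonneg_left (hγ.norm_deriv_le_one _) (norm_nonneg _)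
      _ = ‖ξ p.1‖ := mul_one _
  have hswap : ∫ x, ∫ s in Ico 0 L, f x s = ∫ s in Ico 0 L, ∫ x, f x s :=
    integral_integral_swap hf_int
  -- Step 3: for fixed `s`, the `x`-integral is `⟪J(s), γ'(s)⟫`
  have hinner : ∀ s, ∫ x, f x s = ⟪∫ z, (-lap z) • ξ (z + γ s), deriv γ s⟫ := by
    intro s
    have hg : Integrable fun x : EuclideanSpace ℝ (Fin 3) => (-lap (x - γ s)) • ξ x :=
      ((hlapc.comp (continuous_id.sub continuous_const)).neg.smul hξc).integrable_of_hasCompactSupport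
        hξs.smul_left
    have h1 : ∀ x, f x s = ⟪deriv γ s, (-lap (x - γ s)) • ξ x⟫ := by
      intro x
      show -lap (x - γ s) * ⟪ξ x, deriv γ s⟫ = _
      rw [real_inner_smul_right, real_inner_comm]
    simp_rw [h1]
    rw [integral_inner hg, real_inner_comm]
    congr 1
    rw [← integral_add_right_eq_self (fun x => (-lap (x - γ s)) • ξ x) (γ s)]
    simp
  -- Step 4: bound `⟪J(s), γ'(s)⟫` by the flux lemma
  set E₁ : ℝ := 256 * π * Cg * C₂ * K with hE₁
  set E₂ : ℝ := 2 * Real.sqrt 2 * π * C₃ with hE₂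
  have hbound : ∀ s, ⟪∫ z, (-lap z) • ξ (z + γ s), deriv γ s⟫ ≤
      4 * π * ⟪ξ (γ s), deriv γ s⟫ + (E₁ + E₂) := by
    intro s
    have h := inner_integral_laplacian_smul_le hlapc hε hεL hC₂ hC₃
      (by positivity : (0:ℝ) ≤ 192 * Cg * K) hlap_in hlap_mid hlap_out hflux hξc hξs hsub hξL1
      (γ s) (deriv γ s) (hγ.norm_deriv_le_one s)
    have hE : C₂ * (192 * Cg * K) * (π * 4 / 3) + C₃ * L⁻¹ ^ 3 * (L * (2 * Real.sqrt 2 * π * L ^ 2))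
        = E₁ + E₂ := by
      rw [hE₁, hE₂]; field_simp; ring
    linarith
  -- Step 5: integrate over the period
  have hE : E₁ + E₂ ≤ (256 * π * Cg * C₂ + 2 * Real.sqrt 2 * π * C₃) * K := by
    rw [hE₁, hE₂]
    have : 2 * Real.sqrt 2 * π * C₃ ≤ 2 * Real.sqrt 2 * π * C₃ * K := by
      have h1 : (1:ℝ) ≤ K := by linarith
      nlinarith [show 0 ≤ 2 * Real.sqrt 2 * π * C₃ by positivity]
    nlinarith
  have iT0 : Integrable (fun s => ⟪ξ (γ s), deriv γ s⟫) (volume.restrict (Ico 0 L)) :=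
    hγ.integrable_inner_deriv (u := fun s => ξ (γ s)) (hξc.comp hγc) (fun s => hCξ _)
  have iT : Integrable (fun s => 4 * π * ⟪ξ (γ s), deriv γ s⟫) (volume.restrict (Ico 0 L)) :=
    iT0.const_mul _
  have hstep : ∫ s in Ico 0 L, ∫ x, f x s ≤
      ∫ s in Ico 0 L, (4 * π * ⟪ξ (γ s), deriv γ s⟫ + (E₁ + E₂)) := by
    refine integral_mono_ae hf_int.integral_prod_right (iT.add (integrable_const _))
      (ae_of_all _ fun s => ?_)
    show ∫ x, f x s ≤ 4 * π * ⟪ξ (γ s), deriv γ s⟫ + (E₁ + E₂)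
    rw [hinner s]; exact hbound s
  have hT : ∫ s in Ico 0 L, (4 * π * ⟪ξ (γ s), deriv γ s⟫ + (E₁ + E₂)) =
      4 * π * tangentLineIntegral L γ ξ + (E₁ + E₂) * L := by
    rw [integral_add iT (integrable_const _), integral_const_mul, setIntegral_const,
      measureReal_def, Real.volume_Ico, sub_zero, ENNReal.toReal_ofReal hL.le, smul_eq_mul]
    unfold tangentLineIntegral
    ring
  calc ∫ x, ‖curl ξ x‖ ^ 2 ≤ ∫ x, ∫ s in Ico 0 L, f x s := h0
    _ = ∫ s in Ico 0 L, ∫ x, f x s := hswap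
    _ ≤ 4 * π * tangentLineIntegral L γ ξ + (E₁ + E₂) * L := hstep.trans_eq hT
    _ ≤ 4 * π * tangentLineIntegral L γ ξ +
        (256 * π * Cg * C₂ + 2 * Real.sqrt 2 * π * C₃) * K * L := by
        have := mul_le_mul_of_nonneg_right hE hL.le
        linarith

end MainTerm

end VortexFilament

end Literature.Analysis.FluidPDE
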